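import Literature.AlgebraicGeometry.Motives.AbelianVarietyWeilPairingPullback
import Literature.AlgebraicGeometry.Motives.AbelianVarietyWeilPairingDivisorClass
import Literature.AlgebraicGeometry.Motives.AbelianVarietyWeilPairingAlgClosure
import Literature.AlgebraicGeometry.Motives.AbelianVarietyProduct
import HarnessLib

/-!
# The Weil pairing of a product polarisation: `ē_N^{Θ_A ⊠ Θ_B}((P_A,P_B),(Q_A,Q_B)) = ē_N^{Θ_A}(P_A,Q_A) · ē_N^{Θ_B}(P_B,Q_B)`

Layer `Literature/AlgebraicGeometry/Motives`, namespace `Literature.AlgebraicGeometry.Motives.AbelianVariety`.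
KERNEL ONLY: theorems; no definition, no named fact, no instance, no `sorry`.

For abelian varieties `A`, `B` over a field `K`, their biproduct `A ⊞ B` in the tree's category of abelian
varieties (`Motives/AbelianVarietyProduct`: `A ⊞ B ≅ A ×ₖ B`), Cartier divisors `Θ_A` on `A`, `Θ_B` on `B`,
and the PRODUCT divisor `Θ := pr_A^* Θ_A + pr_B^* Θ_B` on `A ⊞ B` (the divisor of `𝓛_A ⊠ 𝓛_B`; its Riemann
form is the orthogonal sum of those of `Θ_A`, `Θ_B` — Mumford §20, Lang VII §2), the level-`N` Weil pairing
(`Motives/AbelianVarietyWeilPairingLevel`) is the product of the factors' pairings at the projected points: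

  **`ē_N^Θ(P, Q) = ē_N^{Θ_A}(pr_A P, pr_A Q) · ē_N^{Θ_B}(pr_B P, pr_B Q)`**  (`weilPairingLevel_biprod`),

by additivity in the divisor (★ `weilPairingLevel_add`, Lang VII §2 Prop. 3) and functoriality under the dominant
projections (★ `weilPairingLevel_pullback`, Mumford §20 (3)).  Dominance of the projections is the split
epimorphism `inl ≫ fst = 𝟙` (`isDominant_toSchemeHom_of_comp_eq_id`).

Use (cell `hodgecm-mathlib`, road #60 `SiegelS1`, A-p05 memo 035df7a4 §3 M3 (i) «CM-algebra main theorem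
of CM from the field case by `⊞`», leaf R60-15): the polarisation / Riemann-form side of the product of CM abelian
varieties is read componentwise.

## References
* [MumfordAV1970] D. Mumford, *Abelian Varieties* (1970), §20 (property (3) of `e_n`, p. 186; Riemann form of
  `L₁ ⊠ L₂`), §19.
* [Lang1983AbelianVarieties] S. Lang, *Abelian Varieties*, Ch. VII §2, Props. 2–3 (bilinearity in the divisor,
  functoriality).
* [Milne1986AbelianVarieties] J. S. Milne, *Abelian varieties*, in Cornell–Silverman (1986), §16.
-/

universe u

open CategoryTheory CategoryTheory.Limits AlgebraicGeometry

noncomputable section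

namespace Literature.AlgebraicGeometry.Motives

namespace AbelianVariety

variable {K : Type u} [Field K] {A B C : AbelianVariety K}

/-! ### Split epimorphisms of abelian varieties are dominant; the projections of a biproduct -/

/-- A homomorphism of abelian varieties with a section (`s ≫ f = 𝟙`) is dominant on underlying schemes
(it is surjective). [cite: MumfordAV1970, §19 (first paragraph)] -/
theorem isDominant_toSchemeHom_of_comp_eq_id (f : A ⟶ B) (s : B ⟶ A) (h : s ≫ f = 𝟙 B) :
    IsDominant (Hom.toSchemeHom f) := by
  haveI : IsDominant (Hom.toSchemeHom s ≫ Hom.toSchemeHom f) := by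
    rw [show Hom.toSchemeHom s ≫ Hom.toSchemeHom f = Hom.toSchemeHom (s ≫ f) from rfl, h]
    exact inferInstanceAs (IsDominant (𝟙 B.X.left))
  exact IsDominant.of_comp (Hom.toSchemeHom s) (Hom.toSchemeHom f)

variable (A B)

/-- The first projection `A ⊞ B → A` is dominant. [cite: MumfordAV1970, §19 (Hom(A × B, C))] -/
theorem isDominant_toSchemeHom_biprod_fst : IsDominant (Hom.toSchemeHom (biprod.fst : A ⊞ B ⟶ A)) :=
  isDominant_toSchemeHom_of_comp_eq_id _ biprod.inl biprod.inl_fst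

/-- The second projection `A ⊞ B → B` is dominant. [cite: MumfordAV1970, §19 (Hom(A × B, C))] -/
theorem isDominant_toSchemeHom_biprod_snd : IsDominant (Hom.toSchemeHom (biprod.snd : A ⊞ B ⟶ B)) :=
  isDominant_toSchemeHom_of_comp_eq_id _ biprod.inr biprod.inr_snd

variable {A B}

/-! ### The pairing of the product divisor -/

section Level

variable {N : ℕ} [IsDominant (Hom.toSchemeHom ((N : ℤ) • 𝟙 A))] [IsDominant (Hom.toSchemeHom ((N : ℤ) • 𝟙 B))]
  [IsDominant (Hom.toSchemeHom ((N : ℤ) • 𝟙 (A ⊞ B)))]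
-- the projections are dominant (`isDominant_toSchemeHom_biprod_fst/snd`); carried as instance binders so that the
-- pulled-back divisors `pr^* Θ` in the STATEMENTS elaborate (consumers: `haveI := isDominant_toSchemeHom_biprod_fst A B`)
variable [IsDominant (Hom.toSchemeHom (biprod.fst : A ⊞ B ⟶ A))] [IsDominant (Hom.toSchemeHom (biprod.snd : A ⊞ B ⟶ B))]

/-- **The Weil pairing of the product polarisation** `Θ = pr_A^* Θ_A + pr_B^* Θ_B` on `A ⊞ B` is the product of
the factors' pairings at the projections of the points: `ē_N^Θ(P, Q) = ē_N^{Θ_A}(pr_A P, pr_A Q) · ē_N^{Θ_B}(pr_B P, pr_B Q)`.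
[cite: MumfordAV1970, §20 (property (3) of e_n, p. 186)] [cite: Lang1983AbelianVarieties, Ch. VII §2 Prop. 3] -/
theorem weilPairingLevel_biprod (ΘA : CartierDivisor A.X.left) (ΘB : CartierDivisor B.X.left)
    (P Q : (A ⊞ B).torsionPoints K N) :
    (A ⊞ B).weilPairingLevel
        (ΘA.pullback (Hom.toSchemeHom (biprod.fst : A ⊞ B ⟶ A)) +
          ΘB.pullback (Hom.toSchemeHom (biprod.snd : A ⊞ B ⟶ B))) P Q =
      A.weilPairingLevel ΘA
          ⟨AlgPoints.map (biprod.fst : A ⊞ B ⟶ A).hom.hom.hom P.1, map_mem_torsionPoints _ P.2⟩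
          ⟨AlgPoints.map (biprod.fst : A ⊞ B ⟶ A).hom.hom.hom Q.1, map_mem_torsionPoints _ Q.2⟩ *
        B.weilPairingLevel ΘB
          ⟨AlgPoints.map (biprod.snd : A ⊞ B ⟶ B).hom.hom.hom P.1, map_mem_torsionPoints _ P.2⟩
          ⟨AlgPoints.map (biprod.snd : A ⊞ B ⟶ B).hom.hom.hom Q.1, map_mem_torsionPoints _ Q.2⟩ := by
  rw [weilPairingLevel_add, weilPairingLevel_pullback, weilPairingLevel_pullback]

/-- The same with the projected points GIVEN (`P_A = pr_A P`, …, as equations of points), the shape in which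
a product of marked CM abelian varieties is consumed. [cite: MumfordAV1970, §20 (property (3) of e_n, p. 186)] -/
theorem weilPairingLevel_biprod_eq (ΘA : CartierDivisor A.X.left) (ΘB : CartierDivisor B.X.left)
    (P Q : (A ⊞ B).torsionPoints K N) (PA QA : A.torsionPoints K N) (PB QB : B.torsionPoints K N)
    (hPA : (PA : A.Points K) = AlgPoints.map (biprod.fst : A ⊞ B ⟶ A).hom.hom.hom P.1)
    (hQA : (QA : A.Points K) = AlgPoints.map (biprod.fst : A ⊞ B ⟶ A).hom.hom.hom Q.1)
    (hPB : (PB : B.Points K) = AlgPoints.map (biprod.snd : A ⊞ B ⟶ B).hom.hom.hom P.1)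
    (hQB : (QB : B.Points K) = AlgPoints.map (biprod.snd : A ⊞ B ⟶ B).hom.hom.hom Q.1) :
    (A ⊞ B).weilPairingLevel
        (ΘA.pullback (Hom.toSchemeHom (biprod.fst : A ⊞ B ⟶ A)) +
          ΘB.pullback (Hom.toSchemeHom (biprod.snd : A ⊞ B ⟶ B))) P Q =
      A.weilPairingLevel ΘA PA QA * B.weilPairingLevel ΘB PB QB := by
  rw [weilPairingLevel_add, weilPairingLevel_pullback_eq (biprod.fst : A ⊞ B ⟶ A) ΘA P Q PA QA hPA hQA,
    weilPairingLevel_pullback_eq (biprod.snd : A ⊞ B ⟶ B) ΘB P Q PB QB hPB hQB]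

/-- A product divisor that is merely the SAME DIVISOR as `pr_A^* Θ_A + pr_B^* Θ_B` (re-indexed presentation) has
the same product pairing. [cite: Lang1983AbelianVarieties, Ch. VII §2 Prop. 3] -/
theorem weilPairingLevel_eq_of_sameDivisor_biprod {Θ : CartierDivisor (A ⊞ B).X.left} (ΘA : CartierDivisor A.X.left)
    (ΘB : CartierDivisor B.X.left)
    (hΘ : Θ.SameDivisor (ΘA.pullback (Hom.toSchemeHom (biprod.fst : A ⊞ B ⟶ A)) +
      ΘB.pullback (Hom.toSchemeHom (biprod.snd : A ⊞ B ⟶ B))))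
    (P Q : (A ⊞ B).torsionPoints K N) :
    (A ⊞ B).weilPairingLevel Θ P Q =
      A.weilPairingLevel ΘA
          ⟨AlgPoints.map (biprod.fst : A ⊞ B ⟶ A).hom.hom.hom P.1, map_mem_torsionPoints _ P.2⟩
          ⟨AlgPoints.map (biprod.fst : A ⊞ B ⟶ A).hom.hom.hom Q.1, map_mem_torsionPoints _ Q.2⟩ *
        B.weilPairingLevel ΘB
          ⟨AlgPoints.map (biprod.snd : A ⊞ B ⟶ B).hom.hom.hom P.1, map_mem_torsionPoints _ P.2⟩
          ⟨AlgPoints.map (biprod.snd : A ⊞ B ⟶ B).hom.hom.hom Q.1, map_mem_torsionPoints _ Q.2⟩ := by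
  rw [weilPairingLevel_congr_sameDivisor hΘ, weilPairingLevel_biprod]

end Level

/-! ### The invertible-level form (all three `[N]`-dominance binders discharged) -/

/-- **Product pairing, `N` invertible in `K`** (every `[N]` is then an isogeny, hence dominant —
★ `isDominant_toSchemeHom_zsmul_of_ne_zero`; this is the binder-free form for characteristic `0`).
[cite: MumfordAV1970, §20 (property (3) of e_n, p. 186)] [cite: Lang1983AbelianVarieties, Ch. VII §2 Prop. 3] -/
theorem weilPairingLevel_biprod_of_ne_zero {N : ℕ} (hN : (N : K) ≠ 0) (ΘA : CartierDivisor A.X.left)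
    (ΘB : CartierDivisor B.X.left) :
    haveI := isDominant_toSchemeHom_zsmul_of_ne_zero A hN
    haveI := isDominant_toSchemeHom_zsmul_of_ne_zero B hN
    haveI := isDominant_toSchemeHom_zsmul_of_ne_zero (A ⊞ B) hN
    haveI := isDominant_toSchemeHom_biprod_fst A B
    haveI := isDominant_toSchemeHom_biprod_snd A B
    ∀ P Q : (A ⊞ B).torsionPoints K N,
      (A ⊞ B).weilPairingLevel
          (ΘA.pullback (Hom.toSchemeHom (biprod.fst : A ⊞ B ⟶ A)) +
            ΘB.pullback (Hom.toSchemeHom (biprod.snd : A ⊞ B ⟶ B))) P Q =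
        A.weilPairingLevel ΘA
            ⟨AlgPoints.map (biprod.fst : A ⊞ B ⟶ A).hom.hom.hom P.1, map_mem_torsionPoints _ P.2⟩
            ⟨AlgPoints.map (biprod.fst : A ⊞ B ⟶ A).hom.hom.hom Q.1, map_mem_torsionPoints _ Q.2⟩ *
          B.weilPairingLevel ΘB
            ⟨AlgPoints.map (biprod.snd : A ⊞ B ⟶ B).hom.hom.hom P.1, map_mem_torsionPoints _ P.2⟩
            ⟨AlgPoints.map (biprod.snd : A ⊞ B ⟶ B).hom.hom.hom Q.1, map_mem_torsionPoints _ Q.2⟩ := by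
  haveI := isDominant_toSchemeHom_zsmul_of_ne_zero A hN
  haveI := isDominant_toSchemeHom_zsmul_of_ne_zero B hN
  haveI := isDominant_toSchemeHom_zsmul_of_ne_zero (A ⊞ B) hN
  haveI := isDominant_toSchemeHom_biprod_fst A B
  haveI := isDominant_toSchemeHom_biprod_snd A B
  intro P Q
  exact weilPairingLevel_biprod ΘA ΘB P Q

end AbelianVariety

end Literature.AlgebraicGeometry.Motives

end
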